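import Summits.CriticalPhenomena.PercolationContinuityZ3.Theorems.PercNearOneGluingNoHeavyQuantClusterLawCoupling
import Summits.CriticalPhenomena.PercolationContinuityZ3.Theorems.PercNearOneGluingNoHeavyQuantCritTailTransport
import Summits.CriticalPhenomena.PercolationContinuityZ3.Theorems.PercNearOneGluingNoHeavyQuantClusterMomentsSubcritical
import HarnessLib

/-!
# QUANT lane (p4 gen 22): total-variation bounds for the law of the cluster of the origin —
# `sup_𝒜 |P_p(C ∈ 𝒜) − P_{p'}(C ∈ 𝒜)| ≤ a_n(p) + 2d·S_n(p)·(p'−p)/(1−p)`, and the `χ`/`χ^f`-Lipschitz forms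

builds on p205010 (kernel theorem, internal audit signed; external expert review pending) — NOT used in this file.

Sequel of `…QuantClusterLawCoupling` (the coupling inequality `P(C_p ≠ C_{p'}) ≤ …` on Grimmett's label space).  Here the
coupling bounds are turned into statements about `P_p` of CLUSTER EVENTS `B = {ω : C(0)(ω) ∈ 𝒜}` (`𝒜` any family of vertex
sets with `B` measurable), i.e. into bounds on the total-variation distance between the laws of `C(0)` under `P_p` and
`P_{p'}` (`0 ≤ p ≤ p' ≤ 1`, `p < 1`; `a_n(p) = P_p(|C| ≥ n)`, `S_n(p) = Σ_{k<n} a_{k+1}(p) = E_p[|C| ∧ n]`,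
`χ^f(p) = E_p[|C|; |C| < ∞]`):

* §1 `abs_sub_le_real_cl_ne`, `abs_sub_le_real_cl_ne_finite` — `|P_p(B) − P_{p'}(B)| ≤ P(C_p ≠ C_{p'})`, and for
  families of FINITE sets `≤ P(C_p ≠ C_{p'}, |C_p| < ∞)`;
* §2 real forms of the master inequality: **`real_cl_ne_le`** `P(C_p ≠ C_{p'}) ≤ a_n(p) + 2d·S_n(p)·(p'−p)/(1−p)`
  (`Σ_{|S|<n}|∂_E S| P_p(K=S) ≤ 2dΣ_{|S|<n}|S|P_p(K=S) ≤ 2d S_n(p)`), `real_cl_ne_le_linear` (`S_n ≤ n`),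
  **`real_cl_ne_inter_finite_le`** `P(C_p ≠ C_{p'}, |C_p|<∞) ≤ 2dχ^f(p)(p'−p)/(1−p)`,
  **`real_cl_ne_le_theta_add`** `P(C_p ≠ C_{p'}) ≤ θ(p) + 2dχ^f(p)(p'−p)/(1−p)`;
* §3 THE TV THEOREMS for cluster events: **`abs_sub_le_volume_modulus`** (`a_n + 2dS_n t/(1−p)`, every `n`),
  **`abs_sub_le_theta_add_chiF`**, **`abs_sub_le_chiF_of_finite`**, and the p205010-free endpoints of the picture:
  **`abs_sub_le_chi_subcritical`** — below `p_c` the cluster law is locally LIPSCHITZ in total variation with constant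
  `2dχ(p)/(1−p)` (the Aizenman–Newman/Durrett constant), uniformly over all cluster events.

Qualitative precursor in the tree: `continuousAt_bondPercolation_real_of_clusterDetermined` (Hara's lemma: a cluster-
determined event has `p ↦ P_p(E)` continuous where `C` is a.s. finite) — pointwise, per event, no modulus.  HONEST:
elementary; the quantitative/uniform (TV) form is new as typed; no rate at `p_c`.
-/

noncomputable section

namespace Summit.CriticalPhenomena.PercolationContinuityZ3.Theorems.ClusterLaw

open MeasureTheory Literature.Probability.Percolation Literature.Probability.LatticeModels
open scoped ENNReal Classical

variable {d : ℕ}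

/-- `Cℓ[π, U]`: the cluster of the origin in the `π`-open configuration of the labels `U` on `ℤ^d`. -/
local notation3 "Cℓ[" π ", " U "]" => openCluster (configOfLabels π U (zdGraph d)) (0 : Site d)

/-- `cl⁻¹ 𝒜`: the cluster event `{ω | C(0)(ω) ∈ 𝒜}`. -/
local notation3 "cl⁻¹" 𝒜:arg => (fun ω : BondConfig (Site d) => openCluster ω (0 : Site d)) ⁻¹' 𝒜

/-- `a_k(p) = P_p(|C(0)| ≥ k)`. -/
local notation3 "aa" => fun (p : unitInterval) (k : ℕ) =>
  (bondPercolation (zdGraph d) p).real (clusterSizeGe (0 : Site d) k)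

/-- `S_n(p) = Σ_{k<n} a_{k+1}(p) = E_p[|C| ∧ n]`. -/
local notation3 "SS" => fun (p : unitInterval) (n : ℕ) =>
  ∑ k ∈ Finset.range n, (bondPercolation (zdGraph d) p).real (clusterSizeGe (0 : Site d) (k + 1))

/-! ### §1 Cluster events under the coupling -/

/-- Transport of a cluster event: `P(C_p ∈ 𝒜) = P_p(C ∈ 𝒜)`. -/
theorem labelMeasure_real_cl_mem (p : unitInterval) {𝒜 : Set (Set (Site d))} (h𝒜 : MeasurableSet (cl⁻¹ 𝒜)) :
    (labelMeasure (Site d)).real {U | Cℓ[(p : ℝ), U] ∈ 𝒜} = (bondPercolation (zdGraph d) p).real (cl⁻¹ 𝒜) :=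
  labelMeasure_real_setOf_config_mem p h𝒜

/-- The coupling inequality for total variation: `|μ(X ∈ 𝒜) − μ(Y ∈ 𝒜)| ≤ μ(X ≠ Y)`. -/
theorem abs_real_mem_sub_real_mem_le {α β : Type*} [MeasurableSpace α] (μ : Measure α) [IsFiniteMeasure μ]
    (X Y : α → β) (𝒜 : Set β) :
    |μ.real {a | X a ∈ 𝒜} - μ.real {a | Y a ∈ 𝒜}| ≤ μ.real {a | X a ≠ Y a} := by
  have key : ∀ (X' Y' : α → β), μ.real {a | X' a ∈ 𝒜} ≤ μ.real {a | Y' a ∈ 𝒜} + μ.real {a | X' a ≠ Y' a} := by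
    intro X' Y'
    have hsub : {a | X' a ∈ 𝒜} ⊆ {a | Y' a ∈ 𝒜} ∪ {a | X' a ≠ Y' a} := by
      intro a ha
      by_cases h : X' a = Y' a
      · left
        change Y' a ∈ 𝒜
        rw [← h]; exact ha
      · exact Or.inr h
    exact (measureReal_mono hsub (measure_ne_top _ _)).trans (measureReal_union_le _ _)
  have h1 := key X Y
  have h2 := key Y X
  have hsymm : {a | Y a ≠ X a} = {a | X a ≠ Y a} := by ext a; exact ne_comm
  rw [hsymm] at h2
  rw [abs_sub_le_iff]; constructor <;> linarith

/-- **TV by the coupling**: for every cluster event `B = C(0)⁻¹(𝒜)` and `0 ≤ p ≤ p' ≤ 1`,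
`|P_p(B) − P_{p'}(B)| ≤ P(C_p ≠ C_{p'})`. -/
theorem abs_sub_le_real_cl_ne (p p' : unitInterval) {𝒜 : Set (Set (Site d))} (h𝒜 : MeasurableSet (cl⁻¹ 𝒜)) :
    |(bondPercolation (zdGraph d) p).real (cl⁻¹ 𝒜) - (bondPercolation (zdGraph d) p').real (cl⁻¹ 𝒜)| ≤
      (labelMeasure (Site d)).real {U | Cℓ[(p : ℝ), U] ≠ Cℓ[(p' : ℝ), U]} := by
  have := isProbabilityMeasure_labelMeasure (Site d)
  rw [← labelMeasure_real_cl_mem p h𝒜, ← labelMeasure_real_cl_mem p' h𝒜]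
  exact abs_real_mem_sub_real_mem_le (labelMeasure (Site d)) (fun U => Cℓ[(p : ℝ), U]) (fun U => Cℓ[(p' : ℝ), U]) 𝒜

/-- **TV by the coupling, finite-cluster events**: if `𝒜` consists of FINITE vertex sets, then for `p ≤ p'`
`|P_p(C ∈ 𝒜) − P_{p'}(C ∈ 𝒜)| ≤ P(C_p ≠ C_{p'}, |C_p| < ∞)` (if either cluster lies in `𝒜` then `C_p ⊆ C_{p'}` is finite). -/
theorem abs_sub_le_real_cl_ne_finite (p p' : unitInterval) (hpp : p ≤ p') {𝒜 : Set (Set (Site d))}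
    (h𝒜 : MeasurableSet (cl⁻¹ 𝒜)) (hfin : ∀ S ∈ 𝒜, S.Finite) :
    |(bondPercolation (zdGraph d) p).real (cl⁻¹ 𝒜) - (bondPercolation (zdGraph d) p').real (cl⁻¹ 𝒜)| ≤
      (labelMeasure (Site d)).real ({U | Cℓ[(p : ℝ), U] ≠ Cℓ[(p' : ℝ), U]} ∩ {U | (Cℓ[(p : ℝ), U]).Finite}) := by
  have := isProbabilityMeasure_labelMeasure (Site d)
  rw [← labelMeasure_real_cl_mem p h𝒜, ← labelMeasure_real_cl_mem p' h𝒜]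
  set T : Set (Sym2 (Site d) → ℝ) := {U | Cℓ[(p : ℝ), U] ≠ Cℓ[(p' : ℝ), U]} ∩ {U | (Cℓ[(p : ℝ), U]).Finite}
  have hpp' : (p : ℝ) ≤ p' := hpp
  have h1 : {U | Cℓ[(p : ℝ), U] ∈ 𝒜} ⊆ {U | Cℓ[(p' : ℝ), U] ∈ 𝒜} ∪ T := by
    intro U hU
    by_cases h : Cℓ[(p : ℝ), U] = Cℓ[(p' : ℝ), U]
    · left; change Cℓ[(p' : ℝ), U] ∈ 𝒜; rw [← h]; exact hU
    · exact Or.inr ⟨h, hfin _ hU⟩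
  have h2 : {U | Cℓ[(p' : ℝ), U] ∈ 𝒜} ⊆ {U | Cℓ[(p : ℝ), U] ∈ 𝒜} ∪ T := by
    intro U hU
    by_cases h : Cℓ[(p : ℝ), U] = Cℓ[(p' : ℝ), U]
    · left; change Cℓ[(p : ℝ), U] ∈ 𝒜; rw [h]; exact hU
    · exact Or.inr ⟨h, (hfin _ hU).subset (cl_mono U hpp')⟩
  have h1' := (measureReal_mono h1 (measure_ne_top (labelMeasure (Site d)) _)).trans (measureReal_union_le _ _)
  have h2' := (measureReal_mono h2 (measure_ne_top (labelMeasure (Site d)) _)).trans (measureReal_union_le _ _)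
  rw [abs_sub_le_iff]; constructor <;> linarith

/-! ### §2 Real forms of the master inequality -/

/-- The truncated perimeter sum is at most `2d` times the truncated volume sum:
`Σ_{|S|<n} |∂_E S|·P_p(K=S) ≤ 2d · Σ_{|S|<n} |S|·P_p(K=S)`. -/
theorem tsum_perimeter_trunc_le (p : unitInterval) (n : ℕ) :
    ∑' S : Finset (Site d), (if S.card < n then
        ((edgeBoundary (zdGraph d) S).card : ℝ≥0∞) * bondPercolation (zdGraph d) p (clusterIs 0 S) else 0) ≤
      2 * d * ∑' S : Finset (Site d), (if S.card < n then
        (S.card : ℝ≥0∞) * bondPercolation (zdGraph d) p (clusterIs 0 S) else 0) := by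
  rw [← ENNReal.tsum_mul_left]
  refine ENNReal.tsum_le_tsum fun S => ?_
  split_ifs with h
  · rw [← mul_assoc]
    gcongr
    exact_mod_cast card_edgeBoundary_zdGraph_le S
  · simp

/-- `Σ_{|S| ≥ k+1} P_p(K=S) ≤ a_{k+1}(p)` in `ℝ≥0∞`. -/
theorem tsum_measure_clusterIs_card_ge_le (p : unitInterval) (k : ℕ) :
    ∑' S : Finset (Site d), (if k + 1 ≤ S.card then bondPercolation (zdGraph d) p (clusterIs (0 : Site d) S) else 0) ≤
      ENNReal.ofReal (aa p (k + 1)) := by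
  have h := CritTail.hasSum_real_clusterIs_card_ge (zdGraph d) (0 : Site d) p (k + 1)
  have hnn : ∀ S : Finset (Site d), 0 ≤ (if k + 1 ≤ S.card then
      (bondPercolation (zdGraph d) p).real (clusterIs (0 : Site d) S) else 0) := fun S => by
    split_ifs <;> simp [measureReal_nonneg]
  have heq : ∑' S : Finset (Site d), (if k + 1 ≤ S.card then
      bondPercolation (zdGraph d) p (clusterIs (0 : Site d) S) else 0) =
      ENNReal.ofReal (∑' S : Finset (Site d), (if k + 1 ≤ S.card then
        (bondPercolation (zdGraph d) p).real (clusterIs (0 : Site d) S) else 0)) := by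
    rw [ENNReal.ofReal_tsum_of_nonneg hnn h.summable]
    refine tsum_congr fun S => ?_
    split_ifs
    · rw [measureReal_def, ENNReal.ofReal_toReal (measure_ne_top _ _)]
    · simp
  rw [heq, h.tsum_eq]
  have hθ : 0 ≤ theta (zdGraph d) (0 : Site d) p := by unfold theta; exact measureReal_nonneg
  exact ENNReal.ofReal_le_ofReal (by linarith)

/-- The truncated volume sum is at most `S_n`: `Σ_{|S|<n} |S|·P_p(K=S) ≤ S_n(p)` (`|S| ∧ n = Σ_{k<n} 𝟙[k+1 ≤ |S|]`). -/
theorem tsum_volume_trunc_le_SS (p : unitInterval) (n : ℕ) :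
    ∑' S : Finset (Site d), (if S.card < n then
        (S.card : ℝ≥0∞) * bondPercolation (zdGraph d) p (clusterIs 0 S) else 0) ≤ ENNReal.ofReal (SS p n) := by
  have hterm : ∀ S : Finset (Site d), (if S.card < n then
      (S.card : ℝ≥0∞) * bondPercolation (zdGraph d) p (clusterIs 0 S) else 0) ≤
      ∑ k ∈ Finset.range n, (if k + 1 ≤ S.card then bondPercolation (zdGraph d) p (clusterIs (0 : Site d) S) else 0) := by
    intro S
    split_ifs with hS
    · have hcount : ∑ k ∈ Finset.range n, (if k + 1 ≤ S.card then
          bondPercolation (zdGraph d) p (clusterIs (0 : Site d) S) else 0) =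
          (S.card : ℝ≥0∞) * bondPercolation (zdGraph d) p (clusterIs 0 S) := by
        rw [Finset.sum_ite, Finset.sum_const_zero, add_zero, Finset.sum_const, nsmul_eq_mul]
        congr 1
        have : (Finset.range n).filter (fun k => k + 1 ≤ S.card) = Finset.range S.card := by
          ext k; simp only [Finset.mem_filter, Finset.mem_range]; omega
        rw [this, Finset.card_range]
      rw [hcount]
    · exact bot_le
  calc ∑' S : Finset (Site d), (if S.card < n then (S.card : ℝ≥0∞) * bondPercolation (zdGraph d) p (clusterIs 0 S) else 0)
      ≤ ∑' S : Finset (Site d), ∑ k ∈ Finset.range n,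
          (if k + 1 ≤ S.card then bondPercolation (zdGraph d) p (clusterIs (0 : Site d) S) else 0) :=
        ENNReal.tsum_le_tsum hterm
    _ = ∑ k ∈ Finset.range n, ∑' S : Finset (Site d),
          (if k + 1 ≤ S.card then bondPercolation (zdGraph d) p (clusterIs (0 : Site d) S) else 0) :=
        Summable.tsum_finsetSum fun _ _ => ENNReal.summable
    _ ≤ ∑ k ∈ Finset.range n, ENNReal.ofReal (aa p (k + 1)) :=
        Finset.sum_le_sum fun k _ => tsum_measure_clusterIs_card_ge_le p k
    _ = ENNReal.ofReal (SS p n) := by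
        rw [ENNReal.ofReal_sum_of_nonneg fun k _ => measureReal_nonneg]

/-- **Real master inequality (volume-truncated form)**: for `0 ≤ p ≤ p' ≤ 1`, `p < 1`, every `n`:
`P(C_p ≠ C_{p'}) ≤ a_n(p) + 2d · S_n(p) · (p' − p)/(1 − p)`. -/
theorem real_cl_ne_le (p p' : unitInterval) (hpp : p ≤ p') (hp1 : (p : ℝ) < 1) (n : ℕ) :
    (labelMeasure (Site d)).real {U | Cℓ[(p : ℝ), U] ≠ Cℓ[(p' : ℝ), U]} ≤
      aa p n + 2 * d * SS p n * (((p' : ℝ) - p) / (1 - p)) := by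
  have := isProbabilityMeasure_labelMeasure (Site d)
  have hc : 0 ≤ ((p' : ℝ) - p) / (1 - p) := div_nonneg (sub_nonneg.2 hpp) (by linarith)
  have hSS : 0 ≤ SS p n := Finset.sum_nonneg fun k _ => measureReal_nonneg
  have h := measure_cl_ne_le (d := d) p p' hpp hp1 n
  have h2 : ∑' S : Finset (Site d), (if S.card < n then
      ((edgeBoundary (zdGraph d) S).card : ℝ≥0∞) * bondPercolation (zdGraph d) p (clusterIs 0 S) else 0) ≤
      ENNReal.ofReal (2 * d * SS p n) := by
    refine (tsum_perimeter_trunc_le p n).trans ?_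
    rw [ENNReal.ofReal_mul (by positivity), show ENNReal.ofReal (2 * (d : ℝ)) = 2 * d by
      rw [ENNReal.ofReal_mul (by norm_num), ENNReal.ofReal_natCast]; simp]
    gcongr
    exact tsum_volume_trunc_le_SS p n
  have h3 : labelMeasure (Site d) {U | Cℓ[(p : ℝ), U] ≠ Cℓ[(p' : ℝ), U]} ≤
      ENNReal.ofReal (aa p n + 2 * d * SS p n * (((p' : ℝ) - p) / (1 - p))) := by
    refine h.trans ?_
    rw [ENNReal.ofReal_add measureReal_nonneg (by positivity), measureReal_def,
      ENNReal.ofReal_toReal (measure_ne_top _ _), mul_comm (2 * d * SS p n), ENNReal.ofReal_mul hc]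
    gcongr
  rw [measureReal_def]
  exact ENNReal.toReal_le_of_le_ofReal (by positivity) h3

/-- `S_n(p) ≤ n`. -/
theorem SS_le (p : unitInterval) (n : ℕ) : SS p n ≤ n := by
  calc SS p n ≤ ∑ _k ∈ Finset.range n, (1 : ℝ) := Finset.sum_le_sum fun k _ => measureReal_le_one
    _ = n := by simp

/-- **Real master inequality (linear form)**: `P(C_p ≠ C_{p'}) ≤ a_n(p) + 2dn(p'−p)/(1−p)`. -/
theorem real_cl_ne_le_linear (p p' : unitInterval) (hpp : p ≤ p') (hp1 : (p : ℝ) < 1) (n : ℕ) :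
    (labelMeasure (Site d)).real {U | Cℓ[(p : ℝ), U] ≠ Cℓ[(p' : ℝ), U]} ≤
      aa p n + 2 * d * n * (((p' : ℝ) - p) / (1 - p)) := by
  have hc : 0 ≤ ((p' : ℝ) - p) / (1 - p) := div_nonneg (sub_nonneg.2 hpp) (by linarith)
  refine (real_cl_ne_le p p' hpp hp1 n).trans ?_
  gcongr
  exact SS_le p n

/-- **Real master inequality, finite-cluster form**: if `χ^f(p) < ∞` then
`P(C_p ≠ C_{p'}, |C_p| < ∞) ≤ 2d·χ^f(p)·(p'−p)/(1−p)` (`χ^f(p) = meanClusterSize`, `E_p[|∂_E C|; |C|<∞] ≤ 2dχ^f(p)`). -/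
theorem real_cl_ne_inter_finite_le (p p' : unitInterval) (hpp : p ≤ p') (hp1 : (p : ℝ) < 1)
    (hχ : meanClusterSize (zdGraph d) (0 : Site d) p ≠ ⊤) :
    (labelMeasure (Site d)).real ({U | Cℓ[(p : ℝ), U] ≠ Cℓ[(p' : ℝ), U]} ∩ {U | (Cℓ[(p : ℝ), U]).Finite}) ≤
      2 * d * (meanClusterSize (zdGraph d) (0 : Site d) p).toReal * (((p' : ℝ) - p) / (1 - p)) := by
  have := isProbabilityMeasure_labelMeasure (Site d)
  have hc : 0 ≤ ((p' : ℝ) - p) / (1 - p) := div_nonneg (sub_nonneg.2 hpp) (by linarith)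
  have h : labelMeasure (Site d) ({U | Cℓ[(p : ℝ), U] ≠ Cℓ[(p' : ℝ), U]} ∩ {U | (Cℓ[(p : ℝ), U]).Finite}) ≤
      ENNReal.ofReal (((p' : ℝ) - p) / (1 - p)) * (2 * d * meanClusterSize (zdGraph d) (0 : Site d) p) :=
    (measure_cl_ne_inter_finite_le (d := d) p p' hpp hp1).trans (by
      gcongr; exact ThetaPerimeter.perimeter_tsum_le_two_d_mul_chiF (d := d) p)
  rw [measureReal_def]
  refine ENNReal.toReal_le_of_le_ofReal (by positivity) (h.trans_eq ?_)
  rw [mul_comm (2 * (d : ℝ) * _), ENNReal.ofReal_mul hc, ENNReal.ofReal_mul (by positivity),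
    ENNReal.ofReal_toReal hχ, show ENNReal.ofReal (2 * (d : ℝ)) = 2 * d by
      rw [ENNReal.ofReal_mul (by norm_num), ENNReal.ofReal_natCast]; simp]

/-- `P(|C_p| = ∞) = θ(p)` on the label space. -/
theorem labelMeasure_real_cl_infinite (p : unitInterval) :
    (labelMeasure (Site d)).real {U | (Cℓ[(p : ℝ), U]).Infinite} = theta (zdGraph d) 0 p :=
  labelMeasure_real_setOf_config_mem p (measurableSet_percolatesAt_holds (0 : Site d))

/-- **`P(C_p ≠ C_{p'}) ≤ θ(p) + 2d·χ^f(p)·(p'−p)/(1−p)`** (`χ^f(p) < ∞`). -/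
theorem real_cl_ne_le_theta_add (p p' : unitInterval) (hpp : p ≤ p') (hp1 : (p : ℝ) < 1)
    (hχ : meanClusterSize (zdGraph d) (0 : Site d) p ≠ ⊤) :
    (labelMeasure (Site d)).real {U | Cℓ[(p : ℝ), U] ≠ Cℓ[(p' : ℝ), U]} ≤
      theta (zdGraph d) 0 p + 2 * d * (meanClusterSize (zdGraph d) (0 : Site d) p).toReal * (((p' : ℝ) - p) / (1 - p)) := by
  have := isProbabilityMeasure_labelMeasure (Site d)
  have hsub : {U | Cℓ[(p : ℝ), U] ≠ Cℓ[(p' : ℝ), U]} ⊆ {U | (Cℓ[(p : ℝ), U]).Infinite} ∪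
      ({U | Cℓ[(p : ℝ), U] ≠ Cℓ[(p' : ℝ), U]} ∩ {U | (Cℓ[(p : ℝ), U]).Finite}) := by
    intro U hU
    by_cases h : (Cℓ[(p : ℝ), U]).Finite
    · exact Or.inr ⟨hU, h⟩
    · exact Or.inl h
  calc (labelMeasure (Site d)).real {U | Cℓ[(p : ℝ), U] ≠ Cℓ[(p' : ℝ), U]}
      ≤ (labelMeasure (Site d)).real {U | (Cℓ[(p : ℝ), U]).Infinite} +
          (labelMeasure (Site d)).real ({U | Cℓ[(p : ℝ), U] ≠ Cℓ[(p' : ℝ), U]} ∩ {U | (Cℓ[(p : ℝ), U]).Finite}) :=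
        (measureReal_mono hsub (measure_ne_top _ _)).trans (measureReal_union_le _ _)
    _ ≤ _ := by
        rw [labelMeasure_real_cl_infinite]
        gcongr
        exact real_cl_ne_inter_finite_le p p' hpp hp1 hχ

/-! ### §3 The total-variation theorems for cluster events -/

/-- **TV MODULUS OF THE CLUSTER LAW (volume form)**: for every cluster event `B = {C(0) ∈ 𝒜}`, all
`0 ≤ p ≤ p' ≤ 1` with `p < 1`, and every `n`:
`|P_p(B) − P_{p'}(B)| ≤ P_p(|C| ≥ n) + 2d·E_p[|C| ∧ n]·(p'−p)/(1−p)`. -/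
theorem abs_sub_le_volume_modulus (p p' : unitInterval) (hpp : p ≤ p') (hp1 : (p : ℝ) < 1)
    {𝒜 : Set (Set (Site d))} (h𝒜 : MeasurableSet (cl⁻¹ 𝒜)) (n : ℕ) :
    |(bondPercolation (zdGraph d) p).real (cl⁻¹ 𝒜) - (bondPercolation (zdGraph d) p').real (cl⁻¹ 𝒜)| ≤
      aa p n + 2 * d * SS p n * (((p' : ℝ) - p) / (1 - p)) :=
  (abs_sub_le_real_cl_ne p p' h𝒜).trans (real_cl_ne_le p p' hpp hp1 n)

/-- **TV MODULUS OF THE CLUSTER LAW (linear form)**: `|P_p(B) − P_{p'}(B)| ≤ P_p(|C| ≥ n) + 2dn(p'−p)/(1−p)`. -/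
theorem abs_sub_le_linear_modulus (p p' : unitInterval) (hpp : p ≤ p') (hp1 : (p : ℝ) < 1)
    {𝒜 : Set (Set (Site d))} (h𝒜 : MeasurableSet (cl⁻¹ 𝒜)) (n : ℕ) :
    |(bondPercolation (zdGraph d) p).real (cl⁻¹ 𝒜) - (bondPercolation (zdGraph d) p').real (cl⁻¹ 𝒜)| ≤
      aa p n + 2 * d * n * (((p' : ℝ) - p) / (1 - p)) :=
  (abs_sub_le_real_cl_ne p p' h𝒜).trans (real_cl_ne_le_linear p p' hpp hp1 n)

/-- **TV LIPSCHITZ BOUND WITH DEFECT `θ`**: `|P_p(B) − P_{p'}(B)| ≤ θ(p) + 2dχ^f(p)(p'−p)/(1−p)` (`χ^f(p) < ∞`). -/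
theorem abs_sub_le_theta_add_chiF (p p' : unitInterval) (hpp : p ≤ p') (hp1 : (p : ℝ) < 1)
    (hχ : meanClusterSize (zdGraph d) (0 : Site d) p ≠ ⊤) {𝒜 : Set (Set (Site d))} (h𝒜 : MeasurableSet (cl⁻¹ 𝒜)) :
    |(bondPercolation (zdGraph d) p).real (cl⁻¹ 𝒜) - (bondPercolation (zdGraph d) p').real (cl⁻¹ 𝒜)| ≤
      theta (zdGraph d) 0 p + 2 * d * (meanClusterSize (zdGraph d) (0 : Site d) p).toReal * (((p' : ℝ) - p) / (1 - p)) :=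
  (abs_sub_le_real_cl_ne p p' h𝒜).trans (real_cl_ne_le_theta_add p p' hpp hp1 hχ)

/-- **THE FINITE-CLUSTER LAW IS `χ^f`-LIPSCHITZ IN TOTAL VARIATION**: for every family `𝒜` of FINITE vertex sets,
`|P_p(C ∈ 𝒜) − P_{p'}(C ∈ 𝒜)| ≤ 2dχ^f(p)(p'−p)/(1−p)` (`0 ≤ p ≤ p' ≤ 1`, `p < 1`, `χ^f(p) < ∞` — e.g. every
`p ∈ (p_c, 1)` by Kesten–Zhang, `meanClusterSize_lt_top_of_criticalProb_lt`, and every `p < p_c`). -/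
theorem abs_sub_le_chiF_of_finite (p p' : unitInterval) (hpp : p ≤ p') (hp1 : (p : ℝ) < 1)
    (hχ : meanClusterSize (zdGraph d) (0 : Site d) p ≠ ⊤) {𝒜 : Set (Set (Site d))} (h𝒜 : MeasurableSet (cl⁻¹ 𝒜))
    (hfin : ∀ S ∈ 𝒜, S.Finite) :
    |(bondPercolation (zdGraph d) p).real (cl⁻¹ 𝒜) - (bondPercolation (zdGraph d) p').real (cl⁻¹ 𝒜)| ≤
      2 * d * (meanClusterSize (zdGraph d) (0 : Site d) p).toReal * (((p' : ℝ) - p) / (1 - p)) :=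
  (abs_sub_le_real_cl_ne_finite p p' hpp h𝒜 hfin).trans (real_cl_ne_inter_finite_le p p' hpp hp1 hχ)

/-- **BELOW `p_c` THE CLUSTER LAW IS LOCALLY LIPSCHITZ IN TOTAL VARIATION** (`d ≥ 2`): for `p < p_c` and every
`p' ≥ p`, uniformly over all cluster events `B`, `|P_p(B) − P_{p'}(B)| ≤ 2dχ(p)(p'−p)/(1−p)` — the Aizenman–Newman /
Durrett constant `2dχ(p)/(1−p)` (here `χ = χ^f`, `θ(p) = 0`). -/
theorem abs_sub_le_chi_subcritical (hd : 2 ≤ d) (p p' : unitInterval) (hpp : p ≤ p') (hpc : p < criticalProbI d)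
    {𝒜 : Set (Set (Site d))} (h𝒜 : MeasurableSet (cl⁻¹ 𝒜)) :
    |(bondPercolation (zdGraph d) p).real (cl⁻¹ 𝒜) - (bondPercolation (zdGraph d) p').real (cl⁻¹ 𝒜)| ≤
      2 * d * (meanClusterSize (zdGraph d) (0 : Site d) p).toReal * (((p' : ℝ) - p) / (1 - p)) := by
  have hp1 : (p : ℝ) < 1 := lt_of_lt_of_le (show (p : ℝ) < criticalProbI d from hpc) (criticalProbI d).2.2
  have hpc' : (p : ℝ) < criticalProbI d := hpc
  have hθ : theta (zdGraph d) 0 p = 0 :=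
    theta_eq_zero_of_lt_criticalProb_holds (zdGraph d) 0 p (by rwa [coe_criticalProbI] at hpc')
  have hχ : meanClusterSize (zdGraph d) (0 : Site d) p ≠ ⊤ := by
    have h := ChiF.meanClusterSize_prm_lt_top_subcritical (d := d) hd hpc'
    rw [show GhostField.prm (p : ℝ) = p from Set.projIcc_val zero_le_one p] at h
    exact h.ne
  have h := abs_sub_le_theta_add_chiF p p' hpp hp1 hχ h𝒜
  rw [hθ, zero_add] at h
  exact h

end Summit.CriticalPhenomena.PercolationContinuityZ3.Theorems.ClusterLaw
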